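import Summits.QuantumFields.YangMills.Theorems.ColdStartUniversalityLatticeLangevinGaussShift
import Literature.Probability.Process.GaussianTaylorStep
import HarnessLib

/-!
# Route `ColdStartUniversality`, crux K_A1 `UniformColdStartMixing` (stmt-QuantumFields-24809), rung `stub_fixedCutoffMixing`:
# E-block brick 2 — the Gaussian shift identity in dimension `d` (Cameron–Martin for `gaussVec d h`)

Helper file (seat `ym-line-csu-p1`, g7).  For the standard Gaussian vector `gaussVec d h = ⊗_{i<d} N(0, h)` (tree,
`Literature/Probability/Process/GaussianTaylorStep`), every `θ ∈ ℝ^d` and every bounded measurable `g`,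

  `∫ g(x) exp(Σ_i θ_i x_i - h Σ_i θ_i²/2) d(gaussVec d h)(x) = ∫ g(x + h θ) d(gaussVec d h)(x)`

(`integral_mul_exp_gaussVec_eq_integral_add`): induction on `d`, peeling the first coordinate with
`measurePreserving_piFinSuccAbove` and the one-dimensional identity `integral_mul_exp_gaussianReal_eq_integral_add`.
This is the increment-wise change of variables behind the discrete Girsanov formula for Euler schemes (E-block of the g7
plan).  No definition, no sorry.  RECORD-rung R3 plumbing; nothing here bears on the mass gap.
-/

set_option autoImplicit false

noncomputable section

namespace Summit.QuantumFields.YangMills.Theorems.ColdStartUniversality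

open MeasureTheory ProbabilityTheory Filter Finset
open scoped NNReal ENNReal BigOperators
open Literature.Probability.Process (gaussVec)

/-- **Gaussian shift identity in dimension `d`** (Cameron–Martin for `gaussVec d h`): for `h > 0`, `θ ∈ ℝ^d` and bounded
measurable `g`, `∫ g(x) exp(Σ θ_i x_i - h Σ θ_i²/2) dγ = ∫ g(x + h θ) dγ`, `γ = gaussVec d h`. [folklore] -/
theorem integral_mul_exp_gaussVec_eq_integral_add : ∀ (d : ℕ) {h : ℝ≥0} (_ : h ≠ 0) (θ : Fin d → ℝ)
    {g : (Fin d → ℝ) → ℝ} (_ : Measurable g) {C : ℝ} (_ : ∀ x, |g x| ≤ C),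
    ∫ x, g x * Real.exp (∑ i, θ i * x i - (h : ℝ) * (∑ i, θ i ^ 2) / 2) ∂(gaussVec d h) =
      ∫ x, g (fun i => x i + (h : ℝ) * θ i) ∂(gaussVec d h) := by
  intro d
  induction d with
  | zero =>
    intro h hh θ g hg C hC
    refine integral_congr_ae (Eventually.of_forall fun x => ?_)
    have hx : (fun i : Fin 0 => x i + (h : ℝ) * θ i) = x := funext fun i => Fin.elim0 i
    simp [hx]
  | succ d ih =>
    intro h hh θ g hg C hC
    have hC0 : 0 ≤ C := (abs_nonneg _).trans (hC 0)
    -- split off the first coordinate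
    set e := MeasurableEquiv.piFinSuccAbove (fun _ : Fin (d + 1) => ℝ) 0 with he
    have hmp : MeasurePreserving e (gaussVec (d + 1) h) ((gaussianReal 0 h).prod (gaussVec d h)) :=
      measurePreserving_piFinSuccAbove (fun _ : Fin (d + 1) => gaussianReal 0 h) 0
    have hsymm : ∀ p : ℝ × (Fin d → ℝ), e.symm p = Fin.cons p.1 p.2 := by
      intro p
      rw [he, MeasurableEquiv.piFinSuccAbove_symm_apply]
      exact Fin.insertNth_zero' p.1 p.2
    -- rewrite both integrals over the product
    have hL : ∀ (F : (Fin (d + 1) → ℝ) → ℝ), ∫ x, F x ∂(gaussVec (d + 1) h) =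
        ∫ p, F (Fin.cons p.1 p.2) ∂((gaussianReal 0 h).prod (gaussVec d h)) := by
      intro F
      rw [← hmp.symm.integral_comp' (f := e.symm) F]
      simp_rw [hsymm]
    rw [hL, hL]
    -- the exponential weight factorises
    set θ' : Fin d → ℝ := fun j => θ j.succ with hθ'
    have hexp : ∀ (a : ℝ) (y : Fin d → ℝ),
        Real.exp (∑ i, θ i * (Fin.cons a y : Fin (d + 1) → ℝ) i - (h : ℝ) * (∑ i, θ i ^ 2) / 2) =
        Real.exp (θ 0 * a - (h : ℝ) * θ 0 ^ 2 / 2) * Real.exp (∑ j, θ' j * y j - (h : ℝ) * (∑ j, θ' j ^ 2) / 2) := by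
      intro a y
      rw [← Real.exp_add, Fin.sum_univ_succ, Fin.sum_univ_succ]
      simp only [Fin.cons_zero, Fin.cons_succ, hθ']
      ring_nf
    simp_rw [hexp]
    -- integrability on the product
    have hIa : Integrable (fun a : ℝ => Real.exp (θ 0 * a - (h : ℝ) * θ 0 ^ 2 / 2)) (gaussianReal 0 h) := by
      have := (integrable_exp_mul_gaussianReal (μ := 0) (v := h) (θ 0)).mul_const (Real.exp (-((h : ℝ) * θ 0 ^ 2 / 2)))
      refine this.congr (Eventually.of_forall fun a => ?_)
      show Real.exp (θ 0 * a) * Real.exp (-((h : ℝ) * θ 0 ^ 2 / 2)) = Real.exp (θ 0 * a - (h : ℝ) * θ 0 ^ 2 / 2)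
      rw [← Real.exp_add]; ring_nf
    have hIy : Integrable (fun y : Fin d → ℝ => Real.exp (∑ j, θ' j * y j - (h : ℝ) * (∑ j, θ' j ^ 2) / 2)) (gaussVec d h) := by
      -- bounded by the integrable product `∏ exp(θ'_j y_j)` times a constant: use the `d`-dimensional identity with `g = 1`?
      -- Direct route: `gaussVec = Measure.pi`, product of one-dimensional integrable exponentials.
      have hprod : Integrable (fun y : Fin d → ℝ => ∏ j, Real.exp (θ' j * y j)) (gaussVec d h) := by
        unfold gaussVec
        exact Integrable.fintype_prod (f := fun j (t : ℝ) => Real.exp (θ' j * t))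
          (fun j => integrable_exp_mul_gaussianReal (μ := 0) (v := h) (θ' j))
      refine (hprod.mul_const (Real.exp (-((h : ℝ) * (∑ j, θ' j ^ 2) / 2)))).congr (Eventually.of_forall fun y => ?_)
      show (∏ j, Real.exp (θ' j * y j)) * Real.exp (-((h : ℝ) * (∑ j, θ' j ^ 2) / 2)) =
        Real.exp (∑ j, θ' j * y j - (h : ℝ) * (∑ j, θ' j ^ 2) / 2)
      rw [← Real.exp_sum, ← Real.exp_add]; ring_nf
    haveI : IsProbabilityMeasure (gaussVec d h) := by
      unfold gaussVec; infer_instance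
    have hgm : ∀ F : ℝ × (Fin d → ℝ) → (Fin (d + 1) → ℝ), Measurable F → Measurable fun p => g (F p) := fun F hF => hg.comp hF
    have hcons : Measurable fun p : ℝ × (Fin d → ℝ) => (Fin.cons p.1 p.2 : Fin (d + 1) → ℝ) := by
      have : (fun p : ℝ × (Fin d → ℝ) => (Fin.cons p.1 p.2 : Fin (d + 1) → ℝ)) = e.symm := funext fun p => (hsymm p).symm
      rw [this]; exact e.symm.measurable
    have hInt1 : Integrable (fun p : ℝ × (Fin d → ℝ) => g (Fin.cons p.1 p.2) *
        (Real.exp (θ 0 * p.1 - (h : ℝ) * θ 0 ^ 2 / 2) * Real.exp (∑ j, θ' j * p.2 j - (h : ℝ) * (∑ j, θ' j ^ 2) / 2)))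
        ((gaussianReal 0 h).prod (gaussVec d h)) := by
      refine ((hIa.mul_prod hIy).const_mul C).mono' ?_ (Eventually.of_forall fun p => ?_)
      · exact ((hgm _ hcons).mul ((by fun_prop : Measurable fun p : ℝ × (Fin d → ℝ) =>
          Real.exp (θ 0 * p.1 - (h : ℝ) * θ 0 ^ 2 / 2) * Real.exp (∑ j, θ' j * p.2 j - (h : ℝ) * (∑ j, θ' j ^ 2) / 2)))).aestronglyMeasurable
      · rw [Real.norm_eq_abs, abs_mul, abs_of_nonneg (by positivity : (0:ℝ) ≤ Real.exp _ * Real.exp _)]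
        exact mul_le_mul_of_nonneg_right (hC _) (by positivity) |>.trans (le_of_eq (by ring))
    -- first coordinate: Fubini, the one-dimensional identity, Fubini back
    rw [integral_prod _ hInt1]
    have hinner : ∀ y : Fin d → ℝ, ∫ a, g (Fin.cons a y) * (Real.exp (θ 0 * a - (h : ℝ) * θ 0 ^ 2 / 2) *
        Real.exp (∑ j, θ' j * y j - (h : ℝ) * (∑ j, θ' j ^ 2) / 2)) ∂(gaussianReal 0 h) =
        Real.exp (∑ j, θ' j * y j - (h : ℝ) * (∑ j, θ' j ^ 2) / 2) *
          ∫ a, g (Fin.cons (a + (h : ℝ) * θ 0) y) ∂(gaussianReal 0 h) := by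
      intro y
      have h1 := integral_mul_exp_gaussianReal_eq_integral_add hh (θ 0) (g := fun a => g (Fin.cons a y))
        (hg.comp (hcons.comp (measurable_id.prodMk measurable_const)))
      rw [← h1, ← integral_const_mul]
      exact integral_congr_ae (Eventually.of_forall fun a => by ring)
    have hswap : ∫ a, ∫ y, g (Fin.cons a y) * (Real.exp (θ 0 * a - (h : ℝ) * θ 0 ^ 2 / 2) *
        Real.exp (∑ j, θ' j * y j - (h : ℝ) * (∑ j, θ' j ^ 2) / 2)) ∂(gaussVec d h) ∂(gaussianReal 0 h) =
        ∫ y, ∫ a, g (Fin.cons a y) * (Real.exp (θ 0 * a - (h : ℝ) * θ 0 ^ 2 / 2) *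
        Real.exp (∑ j, θ' j * y j - (h : ℝ) * (∑ j, θ' j ^ 2) / 2)) ∂(gaussianReal 0 h) ∂(gaussVec d h) :=
      integral_integral_swap hInt1
    rw [hswap]
    simp_rw [hinner]
    -- second block: the induction hypothesis for `G(y) = ∫ g(cons (a + hθ₀) y) da`
    set G : (Fin d → ℝ) → ℝ := fun y => ∫ a, g (Fin.cons (a + (h : ℝ) * θ 0) y) ∂(gaussianReal 0 h) with hG
    have hGm : Measurable G := by
      have hm : Measurable (Function.uncurry fun (y : Fin d → ℝ) (a : ℝ) => g (Fin.cons (a + (h : ℝ) * θ 0) y)) :=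
        hg.comp (hcons.comp ((measurable_snd.add_const _).prodMk measurable_fst))
      exact (hm.stronglyMeasurable.integral_prod_right').measurable
    have hGC : ∀ y, |G y| ≤ C := by
      intro y
      have := norm_integral_le_of_norm_le_const (μ := gaussianReal 0 h) (f := fun a => g (Fin.cons (a + (h : ℝ) * θ 0) y))
        (C := C) (Eventually.of_forall fun a => by rw [Real.norm_eq_abs]; exact hC _)
      rw [Real.norm_eq_abs] at this
      simpa using this
    have hIH := ih hh θ' hGm hGC
    have hcomm : ∀ y, Real.exp (∑ j, θ' j * y j - (h : ℝ) * (∑ j, θ' j ^ 2) / 2) * G y =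
        G y * Real.exp (∑ j, θ' j * y j - (h : ℝ) * (∑ j, θ' j ^ 2) / 2) := fun y => mul_comm _ _
    have hfold : ∀ y, ∫ a, g (Fin.cons (a + (h : ℝ) * θ 0) y) ∂(gaussianReal 0 h) = G y := fun y => rfl
    simp_rw [hfold, hcomm]
    rw [hIH]
    simp only [hG]
    -- reassemble the right-hand side
    have hInt2 : Integrable (fun p : ℝ × (Fin d → ℝ) => g (fun i => (Fin.cons p.1 p.2 : Fin (d + 1) → ℝ) i + (h : ℝ) * θ i))
        ((gaussianReal 0 h).prod (gaussVec d h)) := by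
      refine Integrable.of_bound ?_ C (Eventually.of_forall fun p => by rw [Real.norm_eq_abs]; exact hC _)
      exact (hg.comp (by
        have : (fun p : ℝ × (Fin d → ℝ) => fun i => (Fin.cons p.1 p.2 : Fin (d + 1) → ℝ) i + (h : ℝ) * θ i) =
            fun p => (Fin.cons p.1 p.2 : Fin (d + 1) → ℝ) + fun i => (h : ℝ) * θ i := rfl
        rw [this]; exact hcons.add_const _)).aestronglyMeasurable
    have hInt3 : Integrable (Function.uncurry fun (y : Fin d → ℝ) (a : ℝ) =>
        g (Fin.cons (a + (h : ℝ) * θ 0) (fun i => y i + (h : ℝ) * θ' i))) ((gaussVec d h).prod (gaussianReal 0 h)) := by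
      refine Integrable.of_bound ?_ C (Eventually.of_forall fun p => by rw [Real.norm_eq_abs]; exact hC _)
      have hm : Measurable fun p : (Fin d → ℝ) × ℝ => (Fin.cons (p.2 + (h : ℝ) * θ 0) (fun i => p.1 i + (h : ℝ) * θ' i) :
          Fin (d + 1) → ℝ) :=
        hcons.comp ((measurable_snd.add_const _).prodMk (measurable_fst.add_const (fun i => (h : ℝ) * θ' i)))
      exact (hg.comp hm).aestronglyMeasurable
    rw [integral_integral_swap hInt3, integral_prod _ hInt2]
    refine integral_congr_ae (Eventually.of_forall fun a => integral_congr_ae (Eventually.of_forall fun y => ?_))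
    show g (Fin.cons (a + (h : ℝ) * θ 0) (fun i => y i + (h : ℝ) * θ' i)) = g (fun i => (Fin.cons a y : Fin (d + 1) → ℝ) i + (h : ℝ) * θ i)
    congr 1
    funext i
    refine Fin.cases ?_ (fun j => ?_) i
    · simp [Fin.cons_zero]
    · simp [Fin.cons_succ, hθ']

end Summit.QuantumFields.YangMills.Theorems.ColdStartUniversality

end
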